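import Mathlib.Algebra.Polynomial.Div
import Mathlib.RingTheory.Polynomial.Basic
import Mathlib.RingTheory.LocalRing.MaximalIdeal.Basic
import Mathlib.RingTheory.Ideal.Maps
import HarnessLib

/-!
# Steer / LEMMA I kernel, file F1: THE POLYNOMIAL LEMMA (PL₁) — «(t̄² − λ)^N ∣ G(t̄) with deg G < 2N forces G ≡ 0 mod 𝔪₀»

OURS (campaign res-hironaka, rung L ★L-G4, slot W4.1, crux `Steer` stmt-ResolutionOfSingularities-16345; res-L0-w41-plan-1 RULING 155a, kernel of
res-L0-w41-idea-3's LEMMA I `InsepStepNotIsolated`; res-L0-w41-stub-3 g7, blueprint `KERNEL-BLUEPRINT-LemmaI.md` 693d33707585fe97 §2; replaces the role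
of no printed item; NOT a statement of the manuscript under review [claim: Hironaka2017, status: under-review]; AI review is weaker than expert review).
Theses-free, definition-free, generic commutative algebra.

The ONE «valuation fact» of the completion-free route to LEMMA I (idea-3's step (3)/(3′) «an inseparable point counts double», here without
completions or coefficient fields). Setting: a local ring `S₀` (the old member), a local DOMAIN `R` (the quotient `S₁ ⧸ I` of the new member by the
ideal of the rational line through the near point), a ring map `ι : S₀ → R` killing an ideal `J₀` (`= 𝔪₀`), an element `v ∈ R` (the class of
`t = Y/X`) and `ℓ ∈ S₀` with `𝔪_R = (v² − ι ℓ)` non-zero, and the LINEAR INDEPENDENCE clause «`ι a + ι b · v ∈ 𝔪_R ⇒ a, b ∈ J₀`» (the near point is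
NOT `κ₀`-rational).

* `eq_C_add_C_mul_X_of_degree_lt_two`, `forall_coeff_mem_of_eq_add_mul` — bookkeeping: a remainder of degree `< 2` is `C b₀ + C b₁ · X`; coefficients along `G = B + Q·A`.
* `polyLemma_one` — **(PL₁)**: for every `N` and every `G ∈ S₀[T]` of degree `< 2N` with `G(v) ∈ 𝔪_R^N`, ALL coefficients of `G` lie in `J₀`
  (Euclid by the monic `T² − ℓ`, the clause, cancellation of `v² − ι ℓ` in the domain `R`, induction on `N`).
* `eval₂_mem_map_of_forall_coeff_mem` — and then `G(w)` lies in the extension of `J₀` along any ring map (used with `S₀ → S₁`: `G(t) ∈ 𝔪₀ S₁ ⊆ X S₁`).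
[cite: Matsumura1987, Thm. 17.10] [folklore]
-/

noncomputable section

-- single-problem summit: the doubled namespace component `ResolutionOfSingularities` is forced
set_option linter.dupNamespace false

namespace Summit.ResolutionOfSingularities.ResolutionOfSingularities.Theorems.SwitchingDichotomy.LemmaI

open IsLocalRing Polynomial

variable {S₀ R : Type*} [CommRing S₀] [CommRing R]

/-- A polynomial of degree `< 2` is `C (coeff 0) + C (coeff 1) · X`. [folklore] -/
theorem eq_C_add_C_mul_X_of_degree_lt_two {B : S₀[X]} (hB : B.degree < 2) :
    B = C (B.coeff 0) + C (B.coeff 1) * X := by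
  have hle : B.degree ≤ 1 := by
    rw [degree_le_iff_coeff_zero]
    intro m hm
    have hm' : 2 ≤ m := by exact_mod_cast (show (1 : WithBot ℕ) < m from hm)
    exact (degree_lt_iff_coeff_zero B 2).mp hB m hm'
  conv_lhs => rw [eq_X_add_C_of_degree_le_one hle]
  ring

/-- All coefficients in an ideal `J` ⇒ the value under `eval₂ φ w` lies in `J.map φ` (any ring map `φ`, any point `w`). [folklore] -/
theorem eval₂_mem_map_of_forall_coeff_mem (φ : S₀ →+* R) (w : R) {J : Ideal S₀} {G : S₀[X]}
    (hG : ∀ j, G.coeff j ∈ J) : G.eval₂ φ w ∈ J.map φ := by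
  rw [eval₂_eq_sum_range]
  exact Submodule.sum_mem _ fun j _ => Ideal.mul_mem_right _ _ (Ideal.mem_map_of_mem φ (hG j))

/-- Coefficient bookkeeping: if `G = B + Q · A` and all coefficients of `A` and of `B` lie in the ideal `J`, so do those of `G`. [folklore] -/
theorem forall_coeff_mem_of_eq_add_mul {J : Ideal S₀} {G Q A B : S₀[X]} (h : B + Q * A = G)
    (hA : ∀ j, A.coeff j ∈ J) (hB : ∀ j, B.coeff j ∈ J) : ∀ j, G.coeff j ∈ J := by
  rw [← Ideal.mem_map_C_iff] at hA hB ⊢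
  rw [← h]
  exact Ideal.add_mem _ hB (Ideal.mul_mem_left _ Q hA)

variable [Nontrivial S₀] [IsLocalRing R] [IsDomain R]

/-- **(PL₁) — the polynomial lemma of the completion-free LEMMA I route.** Let `ι : S₀ → R` be a ring map into a local DOMAIN `R` killing an
ideal `J₀` of `S₀` (in LEMMA I: `S₀` the old member and `J₀ = 𝔪₀`; or `S₀ = κ₀[Z']` and `J₀ = (Z'² − λ₂)` for the degree-4 near point), whose
maximal ideal is principal, generated by the non-zero element `v² − ι ℓ` (`v ∈ R`, `ℓ ∈ S₀`), and assume the LINEAR INDEPENDENCE clause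
«`ι a + ι b · v ∈ 𝔪_R ⇒ a ∈ J₀ ∧ b ∈ J₀`» (the near point is not rational). Then for every `N` and every `G ∈ S₀[T]` of degree `< 2N` with
`G(v) ∈ 𝔪_R ^ N` (evaluation through `ι`), every coefficient of `G` lies in `J₀`. (Euclid by `T² − ℓ`: the remainder `b₀ + b₁T` has
`ι b₀ + ι b₁ v ∈ 𝔪_R`, so it dies under `ι`; cancel one factor `v² − ι ℓ` in the domain `R` and induct on `N`.) This is «an inseparable point
counts double» — Matsumura 17.10 in the one-dimensional regular ring `S₁ ⧸ (X, z')`. [cite: Matsumura1987, Thm. 17.10] [folklore] -/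
theorem polyLemma_one (ι : S₀ →+* R) (J₀ : Ideal S₀) (hι : ∀ m ∈ J₀, ι m = 0) (v : R) (ℓ : S₀)
    (hq : Ideal.span {v ^ 2 - ι ℓ} = maximalIdeal R) (hq0 : v ^ 2 - ι ℓ ≠ 0)
    (hLI : ∀ a b : S₀, ι a + ι b * v ∈ maximalIdeal R → a ∈ J₀ ∧ b ∈ J₀) :
    ∀ (N : ℕ) (G : S₀[X]), G.degree < (2 * N : ℕ) → G.eval₂ ι v ∈ maximalIdeal R ^ N → ∀ j, G.coeff j ∈ J₀ := by
  intro N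
  induction N with
  | zero =>
    intro G hdeg _ j
    have hG : G = 0 := degree_eq_bot.mp (Nat.WithBot.lt_zero_iff.mp (by simpa using hdeg))
    rw [hG, coeff_zero]
    exact zero_mem _
  | succ N ih =>
    intro G hdeg hmem
    set Q : S₀[X] := X ^ 2 - C ℓ with hQ
    have hQm : Q.Monic := monic_X_pow_sub_C ℓ two_ne_zero
    have hQdeg : Q.degree = 2 := by
      rw [hQ, degree_X_pow_sub_C (by norm_num) ℓ]; rfl
    have hQnat : Q.natDegree = 2 := natDegree_eq_of_degree_eq_some hQdeg
    have hdiv : G %ₘ Q + Q * (G /ₘ Q) = G := modByMonic_add_div G Q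
    set A := G /ₘ Q with hA
    set B := G %ₘ Q with hB
    -- the remainder
    have hBdeg : B.degree < 2 := by
      have := degree_modByMonic_lt G hQm
      rwa [hQdeg] at this
    have hBeq : B = C (B.coeff 0) + C (B.coeff 1) * X := eq_C_add_C_mul_X_of_degree_lt_two hBdeg
    -- evaluations
    have hQev : Q.eval₂ ι v = v ^ 2 - ι ℓ := by
      simp [hQ, eval₂_sub, eval₂_pow, eval₂_X, eval₂_C]
    have hBev : B.eval₂ ι v = ι (B.coeff 0) + ι (B.coeff 1) * v := by
      conv_lhs => rw [hBeq]
      simp [eval₂_add, eval₂_mul, eval₂_C, eval₂_X]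
    have hGev : G.eval₂ ι v = B.eval₂ ι v + (v ^ 2 - ι ℓ) * A.eval₂ ι v := by
      conv_lhs => rw [← hdiv]
      rw [eval₂_add, eval₂_mul, hQev]
    -- the remainder dies: `ι b₀ + ι b₁ v ∈ 𝔪_R`
    have hqmem : v ^ 2 - ι ℓ ∈ maximalIdeal R := hq ▸ Ideal.mem_span_singleton_self _
    have hGm : G.eval₂ ι v ∈ maximalIdeal R := Ideal.pow_le_self (Nat.succ_ne_zero N) hmem
    have hBm : ι (B.coeff 0) + ι (B.coeff 1) * v ∈ maximalIdeal R := by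
      have : B.eval₂ ι v = G.eval₂ ι v - (v ^ 2 - ι ℓ) * A.eval₂ ι v := by rw [hGev]; ring
      rw [← hBev, this]
      exact Ideal.sub_mem _ hGm (Ideal.mul_mem_right _ _ hqmem)
    obtain ⟨hb₀, hb₁⟩ := hLI _ _ hBm
    have hBev0 : B.eval₂ ι v = 0 := by rw [hBev, hι _ hb₀, hι _ hb₁, zero_mul, add_zero]
    -- cancel one factor of `v² − ι ℓ`
    have hAmem : A.eval₂ ι v ∈ maximalIdeal R ^ N := by
      have h1 : (v ^ 2 - ι ℓ) * A.eval₂ ι v ∈ Ideal.span {(v ^ 2 - ι ℓ) ^ (N + 1)} := by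
        rw [← Ideal.span_singleton_pow, hq, ← zero_add ((v ^ 2 - ι ℓ) * A.eval₂ ι v), ← hBev0, ← hGev]
        exact hmem
      obtain ⟨r, hr⟩ := Ideal.mem_span_singleton'.mp h1
      have h2 : A.eval₂ ι v = r * (v ^ 2 - ι ℓ) ^ N := by
        apply mul_left_cancel₀ hq0
        rw [← hr]; ring
      rw [h2, ← hq, Ideal.span_singleton_pow]
      exact Ideal.mul_mem_left _ _ (Ideal.mem_span_singleton_self _)
    -- degree of the quotient
    have hAdeg : A.degree < (2 * N : ℕ) := by
      by_cases hlt : G.degree < Q.degree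
      · have hA0 : A = 0 := (divByMonic_eq_zero_iff hQm).mpr hlt
        rw [hA0, degree_zero]
        exact WithBot.bot_lt_coe _
      · have hG0 : G ≠ 0 := by
          rintro rfl
          exact hlt (by rw [degree_zero, hQdeg]; exact WithBot.bot_lt_coe _)
        have hGnat : G.natDegree < 2 * (N + 1) := by
          have := hdeg
          rw [degree_eq_natDegree hG0] at this
          exact_mod_cast this
        have hAnat : A.natDegree = G.natDegree - 2 := by
          rw [hA, natDegree_divByMonic G hQm, hQnat]
        have h2le : 2 ≤ G.natDegree := by
          rw [not_lt, hQdeg, degree_eq_natDegree hG0] at hlt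
          exact_mod_cast hlt
        calc A.degree ≤ (A.natDegree : WithBot ℕ) := degree_le_natDegree
          _ < (2 * N : ℕ) := by exact_mod_cast (show A.natDegree < 2 * N by omega)
    have hAcoeff : ∀ j, A.coeff j ∈ J₀ := ih A hAdeg hAmem
    have hBcoeff : ∀ j, B.coeff j ∈ J₀ := by
      intro j
      rw [hBeq]
      simp only [coeff_add, coeff_C, coeff_C_mul_X]
      refine Ideal.add_mem _ ?_ ?_ <;> split_ifs <;> first | assumption | exact zero_mem _
    exact forall_coeff_mem_of_eq_add_mul hdiv hAcoeff hBcoeff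

end Summit.ResolutionOfSingularities.ResolutionOfSingularities.Theorems.SwitchingDichotomy.LemmaI

end
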